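import Mathlib.Data.NNRat.Defs
import Mathlib.Algebra.Order.Field.Rat
import Literature.AlgebraicGeometry.Frobenioids.DivisorMonoidCategoryTheoreticityDefs
import HarnessLib

/-!
# Frobenioids I, §4: Example 4.3 (Independence of right-hand and left-hand isomorphisms) and
# Remark 4.9.1

Mochizuki, *The geometry of Frobenioids I: the general theory*, Kyushu J. Math. **62** (2008)
293–400, kurims text pp. 81–82, 90 [cite: MochizukiFrdI2008, Ex. 4.3 p.82, Rem. 4.9.1 p.90].

The category `C` of Ex. 4.3 is DEFINED verbatim: "The objects of `C` are the elements of `ℚ`. The morphisms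
`a → b` … are the elements `d ∈ N_{≥1}` such that `d · a ≤ b`; composition of morphisms is defined by
multiplication", over a one-morphism base category `D` with `Φ ≡ ℚ_{≥0}`, with "zero divisor
`b - deg_Fr(φ) · a ∈ ℚ_{≥0}` and Frobenius degree `deg_Fr(φ) ∈ N_{≥1}`" — a second concrete MODEL of
`PreFrobenioidData`. PROVED (all the printed claims of p. 82 about the morphisms of `C`): "`φ : a → b` is a
pre-step iff `deg_Fr(φ) = 1`", "all morphisms of `C` are base-isomorphisms", "no object of `C` is group-like",
"`φ` is of Frobenius type iff `b = deg_Fr(φ) · a`" (every arrow is co-angular), "`0` is Frobenius-trivial",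
"all pull-back morphisms are isomorphisms", "all `O^▷(-)` are trivial", "`C` is of isotropic type", "`D`
is slim". Typed: the self-equivalences `Ψ_λ` with their right-hand and left-hand isomorphisms `id` / `λ ·`
(`claims_psi`), and Rem. 4.9.1 ("the Frobenioid of Example 4.3 is not of rational type", over
the §2 parameters of `IsRational`). Not here: Ex. 4.6, 4.7 (ii) and Ex. 3.6–3.9, which are built on the
general elementary-Frobenioid monoid `F_M` of Def. 1.1 (iii) (cell file of seat abc-iut-found; to be typed
over it after the merge rather than over a third copy). No statement of the paper is strengthened.
-/

namespace Literature.AlgebraicGeometry.Frobenioids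

open CategoryTheory

namespace Ex43

/-- The objects of the category `C` of Ex. 4.3: "the elements of `ℚ`" (FrdI p. 82).
[cite: MochizukiFrdI2008, Ex. 4.3 p.82] -/
structure Obj : Type where
  /-- the rational number -/
  val : ℚ

/-- The morphisms `a → b` of Ex. 4.3: "the elements `d ∈ N_{≥1}` such that `d · a ≤ b`" (FrdI p. 82).
[cite: MochizukiFrdI2008, Ex. 4.3 p.82] -/
@[ext] structure Hom (a b : Obj) : Type where
  /-- the Frobenius degree `d` -/
  deg : ℕ+
  /-- the defining inequality `d · a ≤ b` -/
  le : (deg : ℚ) * a.val ≤ b.val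

/-- "composition of morphisms is defined by multiplication of elements of `N_{≥1}`" (FrdI p. 82): `C` is a
category. [cite: MochizukiFrdI2008, Ex. 4.3 p.82] -/
instance : Category Obj where
  Hom := Hom
  id a := ⟨1, by simp⟩
  comp {a b c} f g := ⟨f.deg * g.deg, by
    have hf := Hom.le f
    have hg := Hom.le g
    have hgpos : (0 : ℚ) < (g.deg : ℚ) := by exact_mod_cast g.deg.pos
    calc ((f.deg * g.deg : ℕ+) : ℚ) * a.val = (g.deg : ℚ) * ((f.deg : ℚ) * a.val) := by push_cast; ring
      _ ≤ (g.deg : ℚ) * b.val := by exact mul_le_mul_of_nonneg_left hf hgpos.le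
      _ ≤ c.val := hg⟩
  id_comp f := Hom.ext (one_mul _)
  comp_id f := Hom.ext (mul_one _)
  assoc f g h := Hom.ext (mul_assoc _ _ _)

/-- Extensionality: a morphism of `C` is determined by its degree. [cite: MochizukiFrdI2008, Ex. 4.3 p.82] -/
@[ext] theorem hom_ext {a b : Obj} {f g : a ⟶ b} (h : f.deg = g.deg) : f = g := Hom.ext h

/-- Degrees multiply under composition. [cite: MochizukiFrdI2008, Ex. 4.3 p.82] -/
@[simp] theorem comp_deg {a b c : Obj} (f : a ⟶ b) (g : b ⟶ c) : (f ≫ g).deg = f.deg * g.deg := rfl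

/-- The identity has degree `1`. [cite: MochizukiFrdI2008, Ex. 4.3 p.82] -/
@[simp] theorem id_deg (a : Obj) : Hom.deg (𝟙 a) = 1 := rfl

/-- The base category `D` of Ex. 4.3: "a one-morphism category" (FrdI p. 82), the one-object category of
the trivial monoid. [cite: MochizukiFrdI2008, Ex. 4.3 p.82] -/
abbrev D : Type := SingleObj PUnit.{1}

/-- The zero divisor of `φ : a → b`: "`b - deg_Fr(φ) · a ∈ ℚ_{≥0}`" (FrdI p. 82).
[cite: MochizukiFrdI2008, Ex. 4.3 p.82] -/
def zeroDiv {a b : Obj} (φ : a ⟶ b) : NNRat := ⟨b.val - (φ.deg : ℚ) * a.val, sub_nonneg.mpr (Hom.le φ)⟩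

/-- The value of the zero divisor in `ℚ`. [cite: MochizukiFrdI2008, Ex. 4.3 p.82] -/
@[simp] theorem coe_zeroDiv {a b : Obj} (φ : a ⟶ b) : (zeroDiv φ : ℚ) = b.val - (φ.deg : ℚ) * a.val := rfl

/-- The operations of Ex. 4.3: "we obtain a natural functor `C → F_Φ` by assigning to a morphism
`φ : a → b` the zero divisor `b - deg_Fr(φ) · a ∈ ℚ_{≥0}` and Frobenius degree `deg_Fr(φ) ∈ N_{≥1}`"
(FrdI p. 82), over the one-morphism category `D` with `Φ ≡ ℚ_{≥0}` (multiplicatively, `Multiplicative ℚ_{≥0}`).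
[cite: MochizukiFrdI2008, Ex. 4.3 p.82] -/
def data : PreFrobenioidData.{0} Obj D where
  base := (Functor.const Obj).obj (SingleObj.star PUnit.{1})
  Mon := fun _ => Multiplicative NNRat
  pull := fun _ => MonoidHom.id _
  pull_id := fun _ _ => rfl
  pull_comp := fun _ _ _ => rfl
  div := fun φ => Multiplicative.ofAdd (zeroDiv φ)
  degFr := fun φ => φ.deg
  div_id := fun a => by
    show Multiplicative.ofAdd (zeroDiv (𝟙 a)) = Multiplicative.ofAdd 0
    congr 1
    ext
    simp
  div_comp := fun ψ φ => by
    show Multiplicative.ofAdd (zeroDiv (ψ ≫ φ)) =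
      Multiplicative.ofAdd (zeroDiv φ) * Multiplicative.ofAdd (zeroDiv ψ) ^ (φ.deg : ℕ)
    rw [← ofAdd_nsmul, ← ofAdd_add]
    congr 1
    ext
    push_cast
    rw [coe_zeroDiv, coe_zeroDiv, coe_zeroDiv, comp_deg]
    push_cast
    ring
  degFr_id := fun _ => rfl
  degFr_comp := fun _ _ => rfl

/-- **Example 4.3** (PROVED): "all morphisms of `C` are base-isomorphisms" (FrdI p. 82).
[cite: MochizukiFrdI2008, Ex. 4.3 p.82] -/
theorem isBaseIso (a b : Obj) (φ : a ⟶ b) : data.IsBaseIso φ := by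
  show IsIso (𝟙 (SingleObj.star PUnit.{1}))
  infer_instance

/-- **Example 4.3** (PROVED): "`φ : a → b` is a pre-step if and only if `deg_Fr(φ) = 1`" (FrdI p. 82).
[cite: MochizukiFrdI2008, Ex. 4.3 p.82] -/
theorem isPreStep_iff {a b : Obj} (φ : a ⟶ b) : data.IsPreStep φ ↔ φ.deg = 1 :=
  ⟨fun h => h.1, fun h => ⟨h, isBaseIso a b φ⟩⟩

/-- **Example 4.3** (PROVED): "no object of `C` is group-like" — `Φ ≡ ℚ_{≥0} ≠ 0` (FrdI p. 82).
[cite: MochizukiFrdI2008, Ex. 4.3 p.82] -/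
theorem not_isGroupLikeObj (a : Obj) : ¬ data.IsGroupLikeObj a := by
  intro h
  have h0 : (Multiplicative.ofAdd (1 : NNRat) : Multiplicative NNRat) = 1 := h (Multiplicative.ofAdd (1 : NNRat))
  have h1 := congrArg Multiplicative.toAdd h0
  rw [toAdd_ofAdd, toAdd_one] at h1
  exact one_ne_zero h1

/-- The one-morphism category `D`: any two parallel arrows coincide. [cite: MochizukiFrdI2008, Ex. 4.3 p.82] -/
theorem D_hom_eq {x y : D} (f g : x ⟶ y) : f = g := rfl

/-- A morphism of degree `1` between objects with the same value is an isomorphism (its inverse is the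
degree-`1` morphism back). [cite: MochizukiFrdI2008, Ex. 4.3 p.82] -/
theorem isIso_of_deg_eq_one {x y : Obj} (β : x ⟶ y) (h1 : β.deg = 1) (h2 : x.val = y.val) : IsIso β :=
  ⟨⟨⟨1, by rw [h2]; simp⟩, hom_ext (by rw [comp_deg, h1, id_deg, mul_one]),
    hom_ext (by rw [comp_deg, h1, id_deg, one_mul])⟩⟩

/-- An isometric pre-step of `C` is an isomorphism. [cite: MochizukiFrdI2008, Ex. 4.3 p.82] -/
theorem isIso_of_isIsometricPreStep {x y : Obj} (β : x ⟶ y) (h : data.IsIsometricPreStep β) : IsIso β := by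
  have h1 : β.deg = 1 := h.1.1
  have h0 : (zeroDiv β : ℚ) = ((0 : NNRat) : ℚ) := by
    have : Multiplicative.ofAdd (zeroDiv β) = Multiplicative.ofAdd (0 : NNRat) := h.2
    rw [Multiplicative.ofAdd.injective this]
  rw [coe_zeroDiv, h1] at h0
  refine isIso_of_deg_eq_one β h1 ?_
  have : ((1 : ℕ+) : ℚ) = 1 := by norm_num
  rw [this, one_mul, NNRat.coe_zero, sub_eq_zero] at h0
  exact h0.symm

/-- **Example 4.3** (PROVED): every morphism of `C` is co-angular (isometric pre-steps being isomorphisms).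
[cite: MochizukiFrdI2008, Ex. 4.3 p.82] -/
theorem isCoAngular {a b : Obj} (φ : a ⟶ b) : data.IsCoAngular φ :=
  fun _ _ _ β _ _ _ hβ _ => isIso_of_isIsometricPreStep β hβ

/-- **Example 4.3** (PROVED): "`C` is … of isotropic type" (FrdI p. 82). [cite: MochizukiFrdI2008, Ex. 4.3 p.82] -/
theorem isOfIsotropicType : data.IsOfIsotropicType :=
  ⟨fun _ _ β hβ => isIso_of_isIsometricPreStep β hβ⟩

/-- **Example 4.3** (PROVED): "`φ : a → b` is a morphism of Frobenius type if and only if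
`b = deg_Fr(φ) · a`" (FrdI p. 82). [cite: MochizukiFrdI2008, Ex. 4.3 p.82] -/
theorem isFrobeniusType_iff {a b : Obj} (φ : a ⟶ b) :
    data.IsFrobeniusType φ ↔ b.val = (Hom.deg φ : ℚ) * a.val := by
  constructor
  · rintro ⟨⟨-, hiso⟩, -⟩
    have : Multiplicative.ofAdd (zeroDiv φ) = Multiplicative.ofAdd (0 : NNRat) := hiso
    have h0 := congrArg (fun q : NNRat => (q : ℚ)) (Multiplicative.ofAdd.injective this)
    simp only [coe_zeroDiv, NNRat.coe_zero] at h0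
    exact (sub_eq_zero.mp h0)
  · intro h
    refine ⟨⟨isCoAngular φ, ?_⟩, isBaseIso a b φ⟩
    show Multiplicative.ofAdd (zeroDiv φ) = Multiplicative.ofAdd (0 : NNRat)
    congr 1
    ext
    rw [coe_zeroDiv, NNRat.coe_zero, h, sub_self]

/-- **Example 4.3** (PROVED): "all `O^▷(-)` of `C` are trivial" (FrdI p. 82): a degree-`1` endomorphism is
the identity. [cite: MochizukiFrdI2008, Ex. 4.3 p.82] -/
theorem endSubmonoid_eq_bot (a : Obj) : data.endSubmonoid a = ⊥ := by
  refine (Submonoid.eq_bot_iff_forall _).mpr fun α hα => ?_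
  exact hom_ext (by rw [show Hom.deg α = 1 from hα.2]; rfl)

/-- The endomorphism of degree `n` of the object `0` (`n · 0 ≤ 0`). [cite: MochizukiFrdI2008, Ex. 4.3 p.82] -/
def frobZero (n : ℕ+) : End (⟨0⟩ : Obj) := ⟨n, by simp⟩

/-- **Example 4.3** (PROVED): "the object `0 ∈ ℚ` is Frobenius-trivial" (FrdI p. 82) — `n ↦` the
endomorphism of degree `n` is a section of `deg_Fr` by base-identity endomorphisms of Frobenius type.
[cite: MochizukiFrdI2008, Ex. 4.3 p.82] -/
theorem isFrobeniusTrivial_zero : data.IsFrobeniusTrivial ⟨0⟩ := by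
  refine ⟨⟨⟨frobZero, rfl⟩, fun m n => hom_ext ?_⟩, fun n => ⟨rfl, rfl, ?_⟩⟩
  · show (m * n : ℕ+) = n * m
    exact mul_comm m n
  · rw [isFrobeniusType_iff]
    simp [frobZero]

/-- **Example 4.3** (PROVED): "all pull-back morphisms of `C` are isomorphisms" (FrdI p. 82): a pull-back
morphism `φ : a → b` has a section `ψ : b → a` (lift of `id_b`), forcing `deg_Fr(φ) = 1`.
[cite: MochizukiFrdI2008, Ex. 4.3 p.82] -/
theorem isIso_of_isPullbackMorphism {a b : Obj} (φ : a ⟶ b) (h : data.IsPullbackMorphism φ) : IsIso φ := by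
  obtain ⟨ψ, ⟨hψ, -⟩, -⟩ := h (𝟙 b) (𝟙 _) (D_hom_eq _ _)
  have hdeg : ψ.deg * φ.deg = 1 := by rw [← comp_deg, hψ, id_deg]
  have hφ : φ.deg = 1 := by
    have := congrArg PNat.val hdeg
    rw [PNat.mul_coe, PNat.one_coe] at this
    exact PNat.coe_injective ((Nat.eq_one_of_mul_eq_one_left this).trans PNat.one_coe.symm)
  have hψ1 : ψ.deg = 1 := by rw [hφ, mul_one] at hdeg; exact hdeg
  exact ⟨⟨ψ, hom_ext (by rw [comp_deg, hφ, hψ1, id_deg, mul_one]), hψ⟩⟩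

/-- **Example 4.3** (PROVED): the one-morphism base category `D` is slim (FrdI p. 82: "over a slim base
category") — it has a single morphism. [cite: MochizukiFrdI2008, Ex. 4.3 p.82] -/
theorem isSlim_D : IsSlim D :=
  ⟨fun _ _ => Iso.ext (NatTrans.ext (funext fun _ => D_hom_eq _ _))⟩

/-- The object map of the self-equivalence `Ψ_λ` (`λ ∈ ℚ_{>0}`): "`a ↦ a`; `-a ↦ -λ · a`" for `a ∈ ℚ_{≥0}`
(FrdI p. 82). [cite: MochizukiFrdI2008, Ex. 4.3 p.82] -/
def psiObj (l : ℚ) (a : Obj) : Obj := if 0 ≤ a.val then a else ⟨l * a.val⟩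

/-- **Example 4.3**, the self-equivalences (typed): for `λ ∈ ℚ_{>0}` there is a self-equivalence `Ψ_λ` of
`C` with object map `psiObj λ` preserving Frobenius degrees, whose right-hand isomorphism (Thm. 4.2 (iii))
at the Frobenius-trivial object `0` is the identity of `ℚ_{≥0}` and whose left-hand isomorphism is
multiplication by `λ` — recorded as: `Ψ_λ` fixes the divisors of co-angular pre-steps out of `0` and
multiplies by `λ` those (through `Base^*`) of co-angular pre-steps into `0` (FrdI p. 82).
[cite: MochizukiFrdI2008, Ex. 4.3 p.82] -/
def claims_psi : Prop :=
  ∀ l : ℚ, 0 < l → ∃ Ψ : Obj ≌ Obj, (∀ a, Ψ.functor.obj a = psiObj l a) ∧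
    (∀ ⦃a b : Obj⦄ (φ : a ⟶ b), (Ψ.functor.map φ).deg = φ.deg) ∧
    (∀ ⦃b : Obj⦄ (φ : (⟨0⟩ : Obj) ⟶ b), data.IsCoAngularPreStep φ →
      (zeroDiv (Ψ.functor.map φ) : ℚ) = zeroDiv φ) ∧
    ∀ ⦃a : Obj⦄ (ψ : a ⟶ ⟨0⟩), data.IsCoAngularPreStep ψ → (zeroDiv (Ψ.functor.map ψ) : ℚ) = l * zeroDiv ψ

/-- **Remark 4.9.1** (typed): "One verifies immediately that the Frobenioid of Example 4.3 is not of rational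
type" (FrdI p. 90) — over the birationalization datum `B` of `C` (Prop. 4.4) and the §2 support predicate
`Supp` of `IsRational`. [cite: MochizukiFrdI2008, Rem. 4.9.1 p.90] -/
def Remark491 (B : data.BiratData) (Supp : ∀ {X : D}, data.Mon X → Primes (data.Mon X) → Prop) : Prop :=
  ∃ a : Obj, ¬ PreFrobenioidData.IsRational B Supp a

end Ex43

end Literature.AlgebraicGeometry.Frobenioids
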